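import Summits.HodgeConjecture.HodgeConjecture.Theorems.F0P3cStCharTSSaHeadTorus8      -- ★ p850852 (this seat): head ₈ (TOR⁵); brings ★ ₇ ₆ ₄, p849458, L1MSplit, VanDijkCore, Ch12Sec5Inputs
import Summits.HodgeConjecture.HodgeConjecture.Theorems.F0P3cStCharTSHbOnMc           -- ★ p850861 (LH6-p04 (g4)) «HB-ON-MC★»: (HCB σ) from the named fact `normalizedCharacter_locallyBounded` (★ p850727) + ★ VanDijkHC
import Summits.HodgeConjecture.HodgeConjecture.Theorems.F0P3cStCharTSDecSigma         -- ★ (LH6-p05 (g3)) «DEC-SIGMA★»: (DEC σ) from (M1)+(CHAR-CL)+★ CAP∕SHELL-VALUE∕EXP-SHELL-DECAY∕decay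
import Summits.HodgeConjecture.HodgeConjecture.Theorems.F0P3cStCharTSL1MSplit         -- ★ p850770 (this seat): «(L1M) SPLIT★» `integrable_of_compactPart_bound_of_shell_decay`
import Summits.HodgeConjecture.HodgeConjecture.Theorems.F0P3cStCharTSVanDijkCore      -- ★ (F0P3a-p07 (g17)) «VDW-CORE»: `continuous_vanDijkWeight` (Δ = |d₀|·|a−1|·√|b−1| unconditionally)
import HarnessLib

/-!
# F0 · P3c · line LH6 «StCharTS» — «Sa-HEAD★» EDITION «(HCB) ↦ HC-BOUNDED, (DEC) PAID»: organ (S-a) with the torus socket cut to the named print fact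
# `normalizedCharacter_locallyBounded` + the residual (TOR⁶) [Rogawski1990 §12.7 L. 12.7.2 (proof) p. 193; §1.6 p. 6; L. 12.5.1 p. 183]

Cell `pub/hodgecm-mathlib`, crux H413 = `stmt-HodgeConjecture-24833` (`--supports` lane, helper), route HCCMUnconditional; seat LH6-p01 (g3), integrator of the (TOR) road.
THEOREMS ONLY, sorry-free, ★-only imports.
THE STATEMENT `stSupportFiniteSqInt_of_carpet_torus₉` = ★ p850852 `stSupportFiniteSqInt_of_carpet_torus₈` with, inside (TOR⁵): (HCB σ) «`|Δ(ι m)·χ_σ(ι m)| ≤ B` on `M_c`» is REPLACED by the NAMED PRINT FACT binder `normalizedCharacter_locallyBounded →` (★ p850727, [HarishChandra1999 Thm. 16.3]) — discharged inside by ★ «HB-ON-MC★» `exists_bound_char_on_torusCompactPart` (p850861); (DEC σ) is DELETED — derived inside by ★ «DEC-SIGMA★» `dec_sigma` from (M1) (local constancy, trace formula through COMPAT `hμG`∕`hreg`) + (CHAR-CL) + the ★ Casselman∕Jacquet chain (CAP p850760, SHELL-VALUE p850719, CHAR-TORUS-VALUE p850818, EXP-SHELL-DECAY p850810, `u3_squareIntegrable_jacquetExponent_decay_holds`).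  What remains is (TOR⁶):
the conjuncts listed in the statement — (HCB-up) «`|Δ·χ_ρ^G| ≤ B` on `M_c`» is print-deep (L. 12.5.1 at `T = M` + Thm. 16.3 on `H`; desk shape (A)).  Binder order
`… hsplit hHC hCL hHCB hTOR aX hcnt hunit hid`.  All other texts VERBATIM.
PROOF.  ★ ₈'s, with the bounds fed to ★ `L1MSplit.integrable_of_compactPart_bound_of_shell_decay` now PRODUCED: `B` from ★ HbOnMc at (`hHCB`, (M1) `hHC`, COMPAT `hμG` `hreg`, `𝔇.IsL2 σ` by
COMPAT `hμGZ`), `C, s` from ★ DecSigma (hypotheses: (M1)(iii)(iv) read through `hreg`∕`hμG`, class-function clause from (CHAR-CL) `hCL`).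
HONEST LABEL: HC_CM is proved only modulo the 7 printed citations (2 remaining: hLiu418 = stmt-HodgeConjecture-24832, h413 = stmt-HodgeConjecture-24833) until rung 0
closes; this head is CONDITIONAL on the named fact `normalizedCharacter_locallyBounded` (UNPROVED `def … : Prop`, ★ p850727) exactly as print is on [Harish-Chandra];
count: (HCB σ) ↦ 1 named fact; (DEC σ) PAID.

## References
* [Rogawski1990] J. D. Rogawski, *Automorphic Representations of Unitary Groups in Three Variables*, Ann. of Math. Stud. 123 (1990): §1.6 pp. 5–6; §12.5 pp. 182–183;
  §12.7 L. 12.7.1 (proof) p. 191, L. 12.7.2 (proof) p. 193.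
* [vanDijk1972] G. van Dijk, *Computation of certain induced characters of p-adic groups*, Math. Ann. 199 (1972), §2, Thm. p. 237.
* [HarishChandra1970] Harish-Chandra, *Harmonic analysis on reductive p-adic groups*, LNM 162 (1970), Lemma 42.
-/

set_option autoImplicit false
-- the mandated namespace has the single-problem summit's repeated segment (`HodgeConjecture.HodgeConjecture`)
set_option linter.dupNamespace false

noncomputable section

open NumberField IsDedekindDomain MeasureTheory MeasureTheory.Measure Filter Topology
open scoped Matrix MatrixGroups BigOperators Pointwise NNReal
open Literature.NumberTheory.Rogawski1990 Literature.NumberTheory.Automorphic Literature.NumberTheory.Automorphic.UnitaryGroup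
open Literature.NumberTheory.GaloisRepresentations
open Literature.MeasureTheory.Group

namespace Summit.HodgeConjecture.HodgeConjecture.Cruxes.H413.F0P3cStCharTSSaHeadTorus9

open Literature.NumberTheory.Rogawski1990.Ch12Sec5
open Summit.HodgeConjecture.HodgeConjecture.Cruxes.H413.F0P3cStCharTSTorusDefs
open Summit.HodgeConjecture.HodgeConjecture.Cruxes.H413.F0P3cStCharTSTorusCompactPart
open Summit.HodgeConjecture.HodgeConjecture.Cruxes.H413.F0P3cStCharTSHyperbolicSet
open Summit.HodgeConjecture.HodgeConjecture.Cruxes.H413.F0P3cStCharTSHyperbolicCore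
open Summit.HodgeConjecture.HodgeConjecture.Cruxes.H413.F0P3cStCharTSPsmTransport
open Summit.HodgeConjecture.HodgeConjecture.Cruxes.H413

set_option maxHeartbeats 1600000 in
-- the statement alone (≈ 240 lines of binders) exceeds the default budget
/-- **«Sa-HEAD★» EDITION «(HCB) ↦ HC-BOUNDED, (DEC) PAID»** — organ (S-a) from the §12.5–12.6 datum (COMPAT 7), the TR carpets, the datum-level sockets incl. (M1)
`CharRegularity` and (CHAR-CL), (SPLIT-NOT-ELL), the NAMED FACT `normalizedCharacter_locallyBounded` [HarishChandra1999 Thm. 16.3] and the residual pointwise torus socket (TOR⁶).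
[cite: Rogawski1990, §12.7 Lemma 12.7.2 (proof) p. 193; §12.5 pp. 182–183; §1.6 pp. 5–6] [cite: Rogawski1990, §12.7 L. 12.7.1 (proof) p. 191] [cite: Casselman1977, Thm. 5.2]
[cite: HarishChandra1999AdmissibleDistributions, Part III §16 Thm. 16.3] [cite: vanDijk1972, §2] -/
theorem stSupportFiniteSqInt_of_carpet_torus₉ :
  ∀ (L : Type) [Field L] [NumberField L] [IsCMField L] (μ : HeckeCharacter L) (ξ : OneDimAutRepH L) (v : HeightOneSpectrum (𝓞 ↥(maximalRealSubfield L))),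
    (∀ w : PlacesOver L v, IsCMField.complexConj L • w.1 = w.1) → μ.IsUnitary →
    (∀ x : Literature.NumberTheory.GaloisRepresentations.ideleGroup ↥(maximalRealSubfield L),
      μ (AdeleRing.ideleBaseChange (↥(maximalRealSubfield L)) L x) = quadraticHeckeCharCM L x) →
    ∀ [MeasurableSpace ((UnitaryGroup.cmDatum L 2 (Matrix.of fun i j : Fin 2 => if i.val + j.val + 1 = 2 then (1 : L) else 0)).Local v × (UnitaryGroup.cmDatum L 1 (Matrix.of fun i j : Fin 1 => if i.val + j.val + 1 = 1 then (1 : L) else 0)).Local v)] [BorelSpace ((UnitaryGroup.cmDatum L 2 (Matrix.of fun i j : Fin 2 => if i.val + j.val + 1 = 2 then (1 : L) else 0)).Local v × (UnitaryGroup.cmDatum L 1 (Matrix.of fun i j : Fin 1 => if i.val + j.val + 1 = 1 then (1 : L) else 0)).Local v)] [MeasurableSpace (Gqs L v)] [BorelSpace (Gqs L v)]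
      (νHv : Measure ((UnitaryGroup.cmDatum L 2 (Matrix.of fun i j : Fin 2 => if i.val + j.val + 1 = 2 then (1 : L) else 0)).Local v × (UnitaryGroup.cmDatum L 1 (Matrix.of fun i j : Fin 1 => if i.val + j.val + 1 = 1 then (1 : L) else 0)).Local v)) (νQv : Measure (Gqs L v))
      [νHv.IsHaarMeasure] [νHv.IsMulRightInvariant] [νQv.IsHaarMeasure] [νQv.IsMulRightInvariant],
    letI : ∀ a : ((UnitaryGroup.cmDatum L 2 (Matrix.of fun i j : Fin 2 => if i.val + j.val + 1 = 2 then (1 : L) else 0)).Local v × (UnitaryGroup.cmDatum L 1 (Matrix.of fun i j : Fin 1 => if i.val + j.val + 1 = 1 then (1 : L) else 0)).Local v), MeasurableSpace (((UnitaryGroup.cmDatum L 2 (Matrix.of fun i j : Fin 2 => if i.val + j.val + 1 = 2 then (1 : L) else 0)).Local v × (UnitaryGroup.cmDatum L 1 (Matrix.of fun i j : Fin 1 => if i.val + j.val + 1 = 1 then (1 : L) else 0)).Local v) ⧸ Subgroup.centralizer ({a} : Set ((UnitaryGroup.cmDatum L 2 (Matrix.of fun i j : Fin 2 => if i.val + j.val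 + 1 = 2 then (1 : L) else 0)).Local v × (UnitaryGroup.cmDatum L 1 (Matrix.of fun i j : Fin 1 => if i.val + j.val + 1 = 1 then (1 : L) else 0)).Local v))) := fun _ => borel _
    haveI : ∀ a : ((UnitaryGroup.cmDatum L 2 (Matrix.of fun i j : Fin 2 => if i.val + j.val + 1 = 2 then (1 : L) else 0)).Local v × (UnitaryGroup.cmDatum L 1 (Matrix.of fun i j : Fin 1 => if i.val + j.val + 1 = 1 then (1 : L) else 0)).Local v), BorelSpace (((UnitaryGroup.cmDatum L 2 (Matrix.of fun i j : Fin 2 => if i.val + j.val + 1 = 2 then (1 : L) else 0)).Local v × (UnitaryGroup.cmDatum L 1 (Matrix.of fun i j : Fin 1 => if i.val + j.val + 1 = 1 then (1 : L) else 0)).Local v) ⧸ Subgroup.centralizer ({a} : Set ((UnitaryGroup.cmDatum L 2 (Matrix.of fun i j : Fin 2 => if i.val + j.val + 1 = 2 then (1 : L) else 0)).Local v × (UnitaryGroup.cmDatum L 1 (Matrix.of fun i j : Fin 1 => if i.val + j.val + 1 = 1 then (1 : L) else 0)).Local v))) := fun _ => ⟨rfl⟩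
    letI : ∀ γ : Gqs L v, MeasurableSpace (Gqs L v ⧸ Subgroup.centralizer ({γ} : Set (Gqs L v))) := fun _ => borel _
    haveI : ∀ γ : Gqs L v, BorelSpace (Gqs L v ⧸ Subgroup.centralizer ({γ} : Set (Gqs L v))) := fun _ => ⟨rfl⟩
    ∀ (mHv : OrbitalMeasureFamily ((UnitaryGroup.cmDatum L 2 (Matrix.of fun i j : Fin 2 => if i.val + j.val + 1 = 2 then (1 : L) else 0)).Local v × (UnitaryGroup.cmDatum L 1 (Matrix.of fun i j : Fin 1 => if i.val + j.val + 1 = 1 then (1 : L) else 0)).Local v)) (mQv : OrbitalMeasureFamily (Gqs L v)),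
      mHv.IsCanonical (IsLocalGRegular L v) νHv →
      mQv.IsCanonical (fun γ => IsRegularElt (γ.val : GL (Fin 3) (UnitaryGroup.LocalRing L v))) νQv →
      IsLocalDeltaTransferExists L (qsForm L) v ((finExplicitCollection L (qsForm L) μ (finExplicitDelta_conj_left_all L (qsForm L) μ) (finExplicitDelta_conj_right_all L (qsForm L) μ)) v) mHv mQv IsLocSmooth IsLocSmooth →
      ∀ (π₁ πSt : IrrClass ((UnitaryGroup.cmDatum L 2 (Matrix.of fun i j : Fin 2 => if i.val + j.val + 1 = 2 then (1 : L) else 0)).Local v × (UnitaryGroup.cmDatum L 1 (Matrix.of fun i j : Fin 1 => if i.val + j.val + 1 = 1 then (1 : L) else 0)).Local v)),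
        HLengthTwoLabels L v
          (torusCharPair (conjLocal L (IsCMField.complexConj L) v) (cmLocalForm L 2 v) (cmLocalForm_eq_over L 2 v) 0
            ((torusLocalComponent L (IsCMField.complexConj L) v ξ.η).comp
                (quotConj (conjLocal L (IsCMField.complexConj L) v) (conjLocal_conjLocal_cm L v)) *
              halfModulusChar (UnitaryGroup.LocalRing L v))
            (torusLocalComponent L (IsCMField.complexConj L) v ξ.ψ))
          ((torusLocalComponent L (IsCMField.complexConj L) v ξ.ψ).comp (localDet (IsCMField.complexConj L) v (isUnit_antidiagOne_det L 1))) π₁ πSt →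
        (∀ fH : ((UnitaryGroup.cmDatum L 2 (Matrix.of fun i j : Fin 2 => if i.val + j.val + 1 = 2 then (1 : L) else 0)).Local v × (UnitaryGroup.cmDatum L 1 (Matrix.of fun i j : Fin 1 => if i.val + j.val + 1 = 1 then (1 : L) else 0)).Local v) → ℂ, IsLocSmooth fH → π₁.smoothTrace νHv fH = charDist (ξ.xiLocalChar v) νHv fH) →
      ∀ [MeasurableSpace (Gqs L v ⧸ Subgroup.center (Gqs L v))] [BorelSpace (Gqs L v ⧸ Subgroup.center (Gqs L v))]
        (μZ : Measure (Gqs L v ⧸ Subgroup.center (Gqs L v))) [μZ.IsHaarMeasure],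
      -- ══ the §12.5–12.6 DATUM on the model (★ TR carpet, a BINDER) and its COMPATIBILITY with the organ's currency (byte-identical with ★ p848567 ∕ ★ p848673) ══
      ∀ (𝔇 : Ch12Sec5.EllipticData (Gqs L v) ((UnitaryGroup.cmDatum L 2 (Matrix.of fun i j : Fin 2 => if i.val + j.val + 1 = 2 then (1 : L) else 0)).Local v × (UnitaryGroup.cmDatum L 1 (Matrix.of fun i j : Fin 1 => if i.val + j.val + 1 = 1 then (1 : L) else 0)).Local v)),
      𝔇.μG = νQv → 𝔇.μH = νHv → 𝔇.μGZ = μZ → 𝔇.orb = mQv →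
      (∀ γ : Gqs L v, γ ∈ 𝔇.regG ↔ IsRegularElt (γ.val : GL (Fin 3) (UnitaryGroup.LocalRing L v))) →
      (∀ (φ : Gqs L v → ℂ) (fH : ((UnitaryGroup.cmDatum L 2 (Matrix.of fun i j : Fin 2 => if i.val + j.val + 1 = 2 then (1 : L) else 0)).Local v × (UnitaryGroup.cmDatum L 1 (Matrix.of fun i j : Fin 1 => if i.val + j.val + 1 = 1 then (1 : L) else 0)).Local v) → ℂ), 𝔇.IsTransfer φ fH ↔ IsLocalDeltaTransfer L (qsForm L) v ((finExplicitCollection L (qsForm L) μ (finExplicitDelta_conj_left_all L (qsForm L) μ) (finExplicitDelta_conj_right_all L (qsForm L) μ)) v) mHv mQv fH φ) →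
      ({πSt} : Finset (IrrClass ((UnitaryGroup.cmDatum L 2 (Matrix.of fun i j : Fin 2 => if i.val + j.val + 1 = 2 then (1 : L) else 0)).Local v × (UnitaryGroup.cmDatum L 1 (Matrix.of fun i j : Fin 1 => if i.val + j.val + 1 = 1 then (1 : L) else 0)).Local v))) ∈ 𝔇.sqPacketsH →
      -- ══ CARPET RELATIONS (named facts of ★ `Ch12Sec5` ∕ ★ `Ch12Sec6`, read at `𝔇`; union of ★ «Sa-COMPOSE» p848625 and ★ (R) p848976) ══
      𝔇.WeylIntegrationFormula → 𝔇.UpSpec → Ch12Sec6.PseudoCoeffExists 𝔇 → Ch12Sec6.PseudoCoeffTrace 𝔇 →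
      Ch12Sec6.Prop1261a 𝔇 → Ch12Sec6.Prop1261b 𝔇 → Ch12Sec6.Prop1261c 𝔇 →
      Ch12Sec6.LdsCharactersOpposite 𝔇 → Ch12Sec6.EllipticOfNotPrincipalSeries 𝔇 → Ch12Sec6.EllipticClassification 𝔇 →
      -- ══ PRINTED INPUTS NO CARPET STATES YET, in the socket shapes of LH6-p01's `Ch12Sec5Inputs` draft: (M1H) `PacketCharRegular`, (UPR) `UpRegular`, (ELL) `EllipticOfL2`,
      --    (DET) `DetNotL2`, (PIN) `PiNNotL2`, (LDS) `LdsNotL2`; and FIVE new sockets for the §12.7 (b)-row: (L2D∀) `D_G·χ_π ∈ L²(T)` for EVERY class, (U2) `D_G·χ_ρ^G ∈ L²(T)`,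
      --    (C1) `cartanG ⊆ cartanAll`, (C2) elliptic representatives a.e. in `G^e`, (C3) the other representatives a.e. in `G^r ∖ G^e` ══
      (∀ ρ ∈ 𝔇.sqPacketsH, Measurable (𝔇.packetCharH ρ) ∧ LocallyIntegrable (𝔇.packetCharH ρ) 𝔇.μH ∧
          Ch12Sec5.IsStableClassFunOn 𝔇.stConjH 𝔇.regH (𝔇.packetCharH ρ) ∧ Ch12Sec5.IsStableClassFunOn 𝔇.stConjH 𝔇.ellH (𝔇.packetCharH ρ) ∧
          ∀ fH : ((UnitaryGroup.cmDatum L 2 (Matrix.of fun i j : Fin 2 => if i.val + j.val + 1 = 2 then (1 : L) else 0)).Local v × (UnitaryGroup.cmDatum L 1 (Matrix.of fun i j : Fin 1 => if i.val + j.val + 1 = 1 then (1 : L) else 0)).Local v) → ℂ, IsLocSmooth fH → (∑ σ ∈ ρ, σ.smoothTrace 𝔇.μH fH) = ∫ h, fH h * 𝔇.packetCharH ρ h ∂𝔇.μH) →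
      (∀ ρ ∈ 𝔇.sqPacketsH, LocallyIntegrable (𝔇.up (𝔇.packetCharH ρ)) 𝔇.μG ∧
          ∀ x ∈ 𝔇.regG, ∀ᶠ y in 𝓝 x, 𝔇.up (𝔇.packetCharH ρ) y = 𝔇.up (𝔇.packetCharH ρ) x) →
      (∀ π : IrrClass (Gqs L v), 𝔇.IsL2 π → 𝔇.IsEllipticRep π) →
      (∀ ψ : ↥(Subgroup.center (Gqs L v)) →* ℂˣ, Continuous ψ → ¬ 𝔇.IsL2 (𝔇.detG ψ)) →
      (∀ ξ' : ((UnitaryGroup.cmDatum L 2 (Matrix.of fun i j : Fin 2 => if i.val + j.val + 1 = 2 then (1 : L) else 0)).Local v × (UnitaryGroup.cmDatum L 1 (Matrix.of fun i j : Fin 1 => if i.val + j.val + 1 = 1 then (1 : L) else 0)).Local v) →* ℂˣ, Continuous ξ' → ¬ 𝔇.IsL2 (𝔇.piN ξ')) →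
      (∀ P ∈ 𝔇.ldsPackets, ∀ σ ∈ P, ¬ 𝔇.IsL2 σ) →
      (∀ π : IrrClass (Gqs L v), ∀ T ∈ 𝔇.cartanG, MemLp (fun t : ↥T => (𝔇.DG (t : Gqs L v) : ℂ) * 𝔇.char π (t : Gqs L v)) 2 (𝔇.μT T)) →
      (∀ ρ ∈ 𝔇.sqPacketsH, ∀ T ∈ 𝔇.cartanG, MemLp (fun t : ↥T => (𝔇.DG (t : Gqs L v) : ℂ) * 𝔇.up (𝔇.packetCharH ρ) (t : Gqs L v)) 2 (𝔇.μT T)) →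
      𝔇.cartanG ⊆ 𝔇.cartanAll →
      (∀ T ∈ 𝔇.cartanG, ∀ᵐ t : ↥T ∂(𝔇.μT T), (t : Gqs L v) ∈ 𝔇.ellG) →
      (∀ T ∈ 𝔇.cartanAll, T ∉ 𝔇.cartanG → ∀ᵐ t : ↥T ∂(𝔇.μT T), (t : Gqs L v) ∈ 𝔇.regG ∧ (t : Gqs L v) ∉ 𝔇.ellG) →
      -- ══ further datum-level sockets of ★ (R) p848976: (LDSE) (LDSU) (LDS2) (R0) (MATE-UNIQ) (ST-L2) (PI2-L2) — (SC-L2) «supercuspidal ⇒ square-integrable» is DISCHARGED below (compact centre at the non-split `v`) ══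
      (∀ P ∈ 𝔇.ldsPackets, ∀ σ ∈ P, 𝔇.IsEllipticRep σ) →
      (∀ P ∈ 𝔇.ldsPackets, ∀ π' ∈ P, ∀ π : IrrClass (Gqs L v), π ∉ P → ¬ 𝔇.IsEllipticPair π π') →
      (∀ P ∈ 𝔇.ldsPackets, ∀ σ ∈ P, ∃ σ' ∈ P, σ' ≠ σ ∧ ∀ τ ∈ P, τ = σ ∨ τ = σ') →
      (∀ P ∈ 𝔇.ldsPackets, ∀ π' ∈ P, ∀ f : Gqs L v → ℂ, 𝔇.IsPseudoCoeff π' f → ∀ fH : ((UnitaryGroup.cmDatum L 2 (Matrix.of fun i j : Fin 2 => if i.val + j.val + 1 = 2 then (1 : L) else 0)).Local v × (UnitaryGroup.cmDatum L 1 (Matrix.of fun i j : Fin 1 => if i.val + j.val + 1 = 1 then (1 : L) else 0)).Local v) → ℂ, IsLocSmooth fH → 𝔇.IsTransfer f fH →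
          (∑ σ ∈ ({πSt} : Finset (IrrClass ((UnitaryGroup.cmDatum L 2 (Matrix.of fun i j : Fin 2 => if i.val + j.val + 1 = 2 then (1 : L) else 0)).Local v × (UnitaryGroup.cmDatum L 1 (Matrix.of fun i j : Fin 1 => if i.val + j.val + 1 = 1 then (1 : L) else 0)).Local v))), σ.smoothTrace 𝔇.μH fH) = 0) →
      (∀ σ u u' : IrrClass (Gqs L v), 𝔇.IsL2 σ → ¬ 𝔇.IsL2 u → ¬ 𝔇.IsL2 u' → 𝔇.IsEllipticPair u σ → 𝔇.IsEllipticPair u' σ → u = u') →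
      (∀ ψ' : ↥(Subgroup.center (Gqs L v)) →* ℂˣ, Continuous ψ' → 𝔇.IsL2 (𝔇.stG ψ')) →
      (∀ ξ' : ((UnitaryGroup.cmDatum L 2 (Matrix.of fun i j : Fin 2 => if i.val + j.val + 1 = 2 then (1 : L) else 0)).Local v × (UnitaryGroup.cmDatum L 1 (Matrix.of fun i j : Fin 1 => if i.val + j.val + 1 = 1 then (1 : L) else 0)).Local v) →* ℂˣ, Continuous ξ' → 𝔇.IsL2 (𝔇.pi2 ξ')) →
      -- ══ THE PRINCIPAL SERIES OF THE NON-SQUARE-INTEGRABLE CLASSES [§12.2]: a parameter map `par` into the tree's PAIR currency, with (PS1) (PS2) (PS3)=(JHL) (NONL2-PAR) (UNIQ-PAR) ══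
      ∀ (par : IrrClass (Gqs L v) → (((UnitaryGroup.LocalRing L v)ˣ →* ℂˣ) × (↥(normOneUnits (conjLocal L (IsCMField.complexConj L) v)) →* ℂˣ))),
      (∀ π ∈ 𝔇.irredPS, ¬ 𝔇.IsL2 π → ∀ f : Gqs L v → ℂ, IsLocSmooth f → π.smoothTrace νQv f = Representation.smoothTrace (G := Gqs L v) (UnitaryGroup.cmPrincipalSeries L 3 v (UnitaryGroup.cmTorusCharPair L v (par π).1 (par π).2)) νQv f) →
      (∀ π σ : IrrClass (Gqs L v), ¬ 𝔇.IsL2 π → 𝔇.IsL2 σ → 𝔇.IsEllipticPair π σ → ∀ f : Gqs L v → ℂ, IsLocSmooth f →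
          π.smoothTrace νQv f + σ.smoothTrace νQv f = Representation.smoothTrace (G := Gqs L v) (UnitaryGroup.cmPrincipalSeries L 3 v (UnitaryGroup.cmTorusCharPair L v (par π).1 (par π).2)) νQv f) →
      (∀ P ∈ 𝔇.ldsPackets, ∀ π' ∈ P, ∀ π'' ∈ P, π' ≠ π'' → par π'' = par π' ∧ ∀ f : Gqs L v → ℂ, IsLocSmooth f →
          π'.smoothTrace νQv f + π''.smoothTrace νQv f = Representation.smoothTrace (G := Gqs L v) (UnitaryGroup.cmPrincipalSeries L 3 v (UnitaryGroup.cmTorusCharPair L v (par π').1 (par π').2)) νQv f) →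
      (∀ π : IrrClass (Gqs L v), ¬ 𝔇.IsL2 π →
          π.IsConstituentOf (UnitaryGroup.cmPrincipalSeries L 3 v (UnitaryGroup.cmTorusCharPair L v (par π).1 (par π).2)) ∧
            Continuous (par π).1 ∧ Continuous (par π).2) →
      (∀ u u' : IrrClass (Gqs L v), ¬ 𝔇.IsL2 u → ¬ 𝔇.IsL2 u' →
          (par u' = par u ∨ par u' = (conjInvChar (conjLocal L (IsCMField.complexConj L) v) (par u).1, (par u).2)) →
          u' = u ∨ ∃ P ∈ 𝔇.ldsPackets, u ∈ P ∧ u' ∈ P) →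
      -- ══ LH6-p05's split-torus block in place of §1's binder `hF` (★ F3′ p849140's sockets, ∀-forms) ══
      -- ══ (SPLIT-NOT-ELL) «a REGULAR element of the split torus `T ⊂ U(Φ₃)(L⁺_v)` is not in `G^e`» [§12.5 p. 184] — the structural socket that ★ «PSE★» `F0P3cStCharTSPsePseudo` trades (PSE) for ══
      (∀ t : ↥(cmBorelTriple L 3 v).M, IsRegularElt ((((t : ↥(unitaryGroupOfForm (conjLocal L (IsCMField.complexConj L) v) (cmLocalForm L 3 v))) : Gqs L v).val : GL (Fin 3) (UnitaryGroup.LocalRing L v))) → ((t : ↥(unitaryGroupOfForm (conjLocal L (IsCMField.complexConj L) v) (cmLocalForm L 3 v))) : Gqs L v) ∉ 𝔇.ellG) →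
      -- ══ (M1) THE PACKAGE'S OWN HARISH-CHANDRA SOCKET `𝔇.CharRegularity` (★ `Ch12Sec5Inputs` :119: for square-integrable `π`, `χ_π` is measurable, locally integrable,
      --    locally constant on `G^{reg}` and represents the trace) [§1.6 pp. 5–6] — a BINDER here (the leaf already carries it among the 19 sockets) ══
      𝔇.CharRegularity →
      -- ══ (CHAR-CL) «the character of a square-integrable `π` is a CLASS FUNCTION on `G^{reg}`» [§1.6 p. 5] — the one clause of ED. 7's (CHAR-G) that (M1) does not state
      --    (it would follow from (M1) for ADMISSIBLE representatives, ★ `smoothTrace_comap` + ★ `IrrClass.comap_eq_self_of_forall_eq_conj`; admissibility is not in the organ's frame) ══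
      (∀ π : IrrClass (Gqs L v), 𝔇.IsL2 π → Ch12Sec5.IsClassFunOn 𝔇.regG (𝔇.char π)) →
      -- ══ (HC-B) HARISH-CHANDRA'S LOCAL BOUNDEDNESS OF THE NORMALISED CHARACTER `|D_G|^{1∕2}·Θ_π` ON COMPACTA — the NAMED PRINT FACT ★ `Rogawski1990.normalizedCharacter_locallyBounded`
      --    (p850727, F0P3-p01 (g21); [HarishChandra1999 Part III §16 Thm. 16.3; Rogawski1990 §1.6 p. 6 «due to Harish-Chandra»]); it PAYS (HCB σ) of ★ ₈'s (TOR⁵) through ★ «HB-ON-MC★»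
      --    `F0P3cStCharTSHbOnMc.exists_bound_char_on_torusCompactPart` (LH6-p04 (g4), p850861; junction `√√‖D(ι m)‖ = Δ(ι m)` ★ «VDW-CORE» (A4)(A6), F0P3a-p07 (g17)) ══
      normalizedCharacter_locallyBounded →
      -- ══ (TOR⁶) THE RESIDUAL TORUS SOCKETS: (DEC σ) is now the THEOREM ★ `…DecSigma.dec_sigma` (LH6-p05 (g3): (M1) local constancy + trace formula, (CHAR-CL), ★ CAP ∕ SHELL-VALUE ∕ EXP-SHELL-DECAY, ★ `u3_squareIntegrable_jacquetExponent_decay_holds`) ══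
        -- (HCB-up) `|D_G χ_ρ^G| ≤ B` on `M_c`, `ρ = St_H(ξ_v)` — PRINT-DEEP, STAYS a socket (desk 09:22:41Z shape (A)): L. 12.5.1 p. 183 at `T = M` + Harish-Chandra Thm. 16.3 on `H` [§1.6 p. 6]
       ((∃ B : ℝ, ∀ m : ((LocalRing L v)ˣ × ↥(normOneUnits (conjLocal L (IsCMField.complexConj L) v))), m ∈ (((Submonoid.pi Set.univ (fun w : PlacesOver L v => (w.1.adicCompletionIntegers L).toSubring.toSubmonoid)).units.prod (⊤ : Subgroup ↥(normOneUnits (conjLocal L (IsCMField.complexConj L) v)))) : Subgroup ((LocalRing L v)ˣ × ↥(normOneUnits (conjLocal L (IsCMField.complexConj L) v)))) →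
          ‖(((vanDijkWeight L v (torusChart L v m)).re : ℝ) : ℂ) * 𝔇.up (𝔇.packetCharH {πSt}) (((torusChart L v m : ↥(cmBorelTriple L 3 v).M) : ↥(unitaryGroupOfForm (conjLocal L (IsCMField.complexConj L) v) (cmLocalForm L 3 v))) : Gqs L v)‖ ≤ B) ∧
        -- (DEC-up) `|D_G χ_ρ^G(ι(α, z))| ≤ C · min(‖α‖, ‖α‖⁻¹)^s` off `M_c` [L. 12.5.1 p. 183; p. 193]
        (∃ C s : ℝ, 0 < s ∧ ∀ m : ((LocalRing L v)ˣ × ↥(normOneUnits (conjLocal L (IsCMField.complexConj L) v))), m ∉ (((Submonoid.pi Set.univ (fun w : PlacesOver L v => (w.1.adicCompletionIntegers L).toSubring.toSubmonoid)).units.prod (⊤ : Subgroup ↥(normOneUnits (conjLocal L (IsCMField.complexConj L) v)))) : Subgroup ((LocalRing L v)ˣ × ↥(normOneUnits (conjLocal L (IsCMField.complexConj L) v)))) →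
          ‖(((vanDijkWeight L v (torusChart L v m)).re : ℝ) : ℂ) * 𝔇.up (𝔇.packetCharH {πSt}) (((torusChart L v m : ↥(cmBorelTriple L 3 v).M) : ↥(unitaryGroupOfForm (conjLocal L (IsCMField.complexConj L) v) (cmLocalForm L 3 v))) : Gqs L v)‖ ≤ C * (min ((unitModulusChar (LocalRing L v) m.1 : ℝ≥0) : ℝ) ((unitModulusChar (LocalRing L v) m.1 : ℝ≥0) : ℝ)⁻¹) ^ s)) →
      ∀ aX : IrrClass (Gqs L v) → ℤ, (Function.support aX).Countable →
        (∀ π : IrrClass (Gqs L v), aX π ≠ 0 → π.IsUnitarizable) →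
        (∀ (fH : ((UnitaryGroup.cmDatum L 2 (Matrix.of fun i j : Fin 2 => if i.val + j.val + 1 = 2 then (1 : L) else 0)).Local v × (UnitaryGroup.cmDatum L 1 (Matrix.of fun i j : Fin 1 => if i.val + j.val + 1 = 1 then (1 : L) else 0)).Local v) → ℂ) (φ : Gqs L v → ℂ), IsLocSmooth fH → IsLocSmooth φ →
            IsLocalDeltaTransfer L (qsForm L) v ((finExplicitCollection L (qsForm L) μ (finExplicitDelta_conj_left_all L (qsForm L) μ) (finExplicitDelta_conj_right_all L (qsForm L) μ)) v) mHv mQv fH φ →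
            Summable (fun π : IrrClass (Gqs L v) => (aX π : ℂ) * π.smoothTrace νQv φ) ∧
              ∑' π : IrrClass (Gqs L v), (aX π : ℂ) * π.smoothTrace νQv φ = πSt.smoothTrace νHv fH) →
        (Function.support aX).Finite ∧ ∀ π : IrrClass (Gqs L v), aX π ≠ 0 → π.IsSquareIntegrable μZ := by
  intro L _ _ _ μ ξ v hns hμu hμω _ _ _ _ νHv νQv _ _ _ _ mHv mQv hcanH hcanQ hTv π₁ πSt hHL hπ₁ _ _ μZ _
    𝔇 hμG hμH hμGZ horb hreg hTr hρ hW hUp hPCE hPCT h61a h61b h61c hLO hEONPS hEC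
    hHCH hUpReg hEll hDet hPiN hLds hL2domAll hUdom hsub hTell hTnon
    hLdsE hLdsU hLds2 hR0 hMU hStL2 hPi2L2
    par hPS1 hPS2 hPS3 hNP hUP
    hsplit hHC hCL hHCB hTOR
    aX hcnt hunit hid
  -- the organ's quotient σ-algebras and the Borel structure of `M`, re-installed as local instances
  letI : ∀ γ : Gqs L v, MeasurableSpace (Gqs L v ⧸ Subgroup.centralizer ({γ} : Set (Gqs L v))) := fun _ => borel _
  haveI : ∀ γ : Gqs L v, BorelSpace (Gqs L v ⧸ Subgroup.centralizer ({γ} : Set (Gqs L v))) := fun _ => ⟨rfl⟩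
  letI : MeasurableSpace ((UnitaryGroup.LocalRing L v)ˣ × ↥(normOneUnits (conjLocal L (IsCMField.complexConj L) v))) := borel _
  haveI : BorelSpace ((UnitaryGroup.LocalRing L v)ˣ × ↥(normOneUnits (conjLocal L (IsCMField.complexConj L) v))) := ⟨rfl⟩
  -- «VDW-SYMM★» (LH6-p02 (g2), ★ p849696): the W-invariance of van Dijk's weight, read through ★ `vanDijkWeight` (as in ★ p849719)
  have hVDW : ∀ (w₀ : ↥(unitaryGroupOfForm (conjLocal L (IsCMField.complexConj L) v) (cmLocalForm L 3 v))) (hw₀ : Units.val (w₀ : GL (Fin 3) (UnitaryGroup.LocalRing L v)) = cmLocalForm L 3 v) (t : ↥(cmBorelTriple L 3 v).M),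
      vanDijkWeight L v ⟨w₀ * (t : ↥(unitaryGroupOfForm (conjLocal L (IsCMField.complexConj L) v) (cmLocalForm L 3 v))) * w₀⁻¹, weylConj_mem_cmTorus L v w₀ hw₀ t⟩ = vanDijkWeight L v t :=
    fun w₀ hw₀ t => F0P3cStCharTSVanDijkWeylSymm.vanDijkWeight_weylConj L v w₀ hw₀ t ⟨w₀ * (t : ↥(unitaryGroupOfForm (conjLocal L (IsCMField.complexConj L) v) (cmLocalForm L 3 v))) * w₀⁻¹, weylConj_mem_cmTorus L v w₀ hw₀ t⟩ rfl
  -- the place `w` of the package and the core `Ω°` at `w`: regular (★ (H3′)), inside the hyperbolic set (★ (H3)), hence class functions on `G^{reg}` are conj-invariant on it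
  obtain ⟨w⟩ : Nonempty (PlacesOver L v) := inferInstance
  have hΩreg : {γ : Gqs L v | 1 < Valued.v ((Pi.evalRingHom (fun w' : PlacesOver L v => w'.1.adicCompletion L) w) ((γ.val : GL (Fin 3) (UnitaryGroup.LocalRing L v)) : Matrix (Fin 3) (Fin 3) (UnitaryGroup.LocalRing L v)).trace)} ⊆ {γ : Gqs L v | IsRegularElt (γ.val : GL (Fin 3) (UnitaryGroup.LocalRing L v))} :=
    setOf_one_lt_v_trace_subset_setOf_isRegularElt L v hns w
  have hΩhyp : {γ : Gqs L v | 1 < Valued.v ((Pi.evalRingHom (fun w' : PlacesOver L v => w'.1.adicCompletion L) w) ((γ.val : GL (Fin 3) (UnitaryGroup.LocalRing L v)) : Matrix (Fin 3) (Fin 3) (UnitaryGroup.LocalRing L v)).trace)} ⊆ hyperbolicSet L v :=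
    setOf_one_lt_v_trace_subset_hyperbolicSet L v hns w
  have hclΩ : ∀ α : Gqs L v → ℂ, Ch12Sec5.IsClassFunOn 𝔇.regG α → ∀ g ∈ {γ : Gqs L v | 1 < Valued.v ((Pi.evalRingHom (fun w' : PlacesOver L v => w'.1.adicCompletion L) w) ((γ.val : GL (Fin 3) (UnitaryGroup.LocalRing L v)) : Matrix (Fin 3) (Fin 3) (UnitaryGroup.LocalRing L v)).trace)}, ∀ h : Gqs L v, α (h * g * h⁻¹) = α g :=
    fun α hα g hg h => hα g ((hreg g).mpr (hΩreg hg)) h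
  refine F0P3cStCharTSSaHeadTorus.stSupportFiniteSqInt_of_carpet_torus L μ ξ v hns hμu hμω νHv νQv mHv mQv hcanH hcanQ hTv π₁ πSt hHL hπ₁ μZ
    𝔇 hμG hμH hμGZ horb hreg hTr hρ hW hUp hPCE hPCT h61a h61b h61c hLO hEONPS hEC hHCH hUpReg hEll hDet hPiN hLds hL2domAll hUdom hsub hTell hTnon
    hLdsE hLdsU hLds2 hR0 hMU hStL2 hPi2L2 par hPS1 hPS2 hPS3 hNP hUP hsplit ?_ aX hcnt hunit hid
  -- ══ (TOR) of ★ p849458 from (M1)+(CHAR-CL)+(TOR⁵): (L1M)(L1M-up) by ★ «(L1M) SPLIT★»; `Ω := Ω°`, pin `rfl`; (WIF°) at `Δ∘ι` = ★ `weylIntegration_core_of_shells` over ★ shells (+ the `M_c` congruence of ★ ₆); (SHF′°) = ★ `shf_core` ══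
  intro μM _
  obtain ⟨⟨Bup, hBup⟩, ⟨Cup, sup, hsup, hCup⟩⟩ := hTOR
  -- (L1M)(L1M-up) for THIS `μM` by ★ «(L1M) SPLIT★» (p850770) from: (HCB σ) ★ HbOnMc over the named fact, (DEC σ) ★ DecSigma, (HCB-up) socket, (DEC-up) socket; measurability: `Δ` continuous («VDW-CORE»), `ι` continuous (★ `continuous_torusChart`), `χ` measurable ((M1) ∕ `UpSpec`)
  have hΔc : Continuous (vanDijkWeight L v) := F0P3cStCharTSVanDijkCore.continuous_vanDijkWeight L v hns
  have hιm : @Measurable ((LocalRing L v)ˣ × ↥(normOneUnits (conjLocal L (IsCMField.complexConj L) v))) (Gqs L v) _ _ fun m => (((torusChart L v m : ↥(cmBorelTriple L 3 v).M) : ↥(unitaryGroupOfForm (conjLocal L (IsCMField.complexConj L) v) (cmLocalForm L 3 v))) : Gqs L v) := by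
    have hc : @Continuous ((LocalRing L v)ˣ × ↥(normOneUnits (conjLocal L (IsCMField.complexConj L) v))) (Gqs L v) _ _ fun m => (((torusChart L v m : ↥(cmBorelTriple L 3 v).M) : ↥(unitaryGroupOfForm (conjLocal L (IsCMField.complexConj L) v) (cmLocalForm L 3 v))) : Gqs L v) := continuous_subtype_val.comp (F0P3cStCharTSTorusChartIso.continuous_torusChart L v)
    exact hc.measurable
  have hΔm : Measurable fun m : ((LocalRing L v)ˣ × ↥(normOneUnits (conjLocal L (IsCMField.complexConj L) v))) => (((vanDijkWeight L v (torusChart L v m)).re : ℝ) : ℂ) :=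
    (Complex.continuous_ofReal.comp (Complex.continuous_re.comp (hΔc.comp (F0P3cStCharTSTorusChartIso.continuous_torusChart L v)))).measurable
  have hL1 : ∀ σ : IrrClass (Gqs L v), σ.IsSquareIntegrable μZ →
      Integrable (fun m : ((LocalRing L v)ˣ × ↥(normOneUnits (conjLocal L (IsCMField.complexConj L) v))) => (((vanDijkWeight L v (torusChart L v m)).re : ℝ) : ℂ) * 𝔇.char σ (((torusChart L v m : ↥(cmBorelTriple L 3 v).M) : ↥(unitaryGroupOfForm (conjLocal L (IsCMField.complexConj L) v) (cmLocalForm L 3 v))) : Gqs L v)) μM := fun σ hσ => by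
    have hL2 : 𝔇.IsL2 σ := by
      show IrrClass.IsSquareIntegrable 𝔇.μGZ σ
      rw [hμGZ]; exact hσ
    obtain ⟨hmeas, -, hlc, htr⟩ := hHC σ hL2
    obtain ⟨B, hB⟩ := F0P3cStCharTSHbOnMc.exists_bound_char_on_torusCompactPart L v hHCB hns νQv 𝔇 hHC hμG hreg σ hL2
    have hΘloc : ∀ x : Gqs L v, IsRegularElt (x.val : GL (Fin 3) (UnitaryGroup.LocalRing L v)) → ∀ᶠ y in 𝓝 x, 𝔇.char σ y = 𝔇.char σ x :=
      fun x hx => hlc x ((hreg x).2 hx)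
    have hΘtr : ∀ φ : Gqs L v → ℂ, IsLocSmooth φ → σ.smoothTrace νQv φ = ∫ x, φ x * 𝔇.char σ x ∂νQv := by
      intro φ hφ; have h := htr φ hφ; rwa [hμG] at h
    have hΘcl : ∀ g : Gqs L v, IsRegularElt (g.val : GL (Fin 3) (UnitaryGroup.LocalRing L v)) → ∀ h : Gqs L v, 𝔇.char σ (h * g * h⁻¹) = 𝔇.char σ g :=
      fun g hg h => hCL σ hL2 g ((hreg g).2 hg) h
    obtain ⟨C, s, hs, hC⟩ := F0P3cStCharTSDecSigma.dec_sigma L v hns w μZ νQv σ hσ (𝔇.char σ) hΘloc hΘtr hΘcl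
    exact F0P3cStCharTSL1MSplit.integrable_of_compactPart_bound_of_shell_decay L v hns μM _ (hΔm.mul (hmeas.comp hιm)).aestronglyMeasurable B hB C s hs hC
  obtain ⟨Mlev, hMo, hMa, hMb, hM0, hMr, hSH⟩ := F0P3cStCharTSShellsTTLevels.exists_levels_shellsTT L v hns w νQv hcanQ μM
  have hWIF0 := F0P3cStCharTSWeylCoreDensity.weylIntegration_core_of_shells L v hns w νQv hcanQ μM Mlev hMo hMa hMb hM0 hMr hSH
  have hSHF := F0P3cStCharTSShellsTTLevels.shf_core L v hns w νQv hcanQ μM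
  -- (WIF°) at the print-exact density `Δ ∘ ι` (★ ₆'s congruence: `= max(‖α‖,‖α‖⁻¹)` off `M_c` ★ `vanDijkWeight_torusChart_of_not_mem`; on `M_c` the torus transform of an `Ω°`-supported `φ` is `0`)
  have hWIF :
      (∀ α : Gqs L v → ℂ, Measurable α → LocallyIntegrable α νQv → (∀ g ∈ {γ : Gqs L v | 1 < Valued.v ((Pi.evalRingHom (fun w' : PlacesOver L v => w'.1.adicCompletion L) w) ((γ.val : GL (Fin 3) (UnitaryGroup.LocalRing L v)) : Matrix (Fin 3) (Fin 3) (UnitaryGroup.LocalRing L v)).trace)}, ∀ h : Gqs L v, α (h * g * h⁻¹) = α g) →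
      ∀ φ : Gqs L v → ℂ, IsLocSmooth φ → tsupport φ ⊆ {γ : Gqs L v | 1 < Valued.v ((Pi.evalRingHom (fun w' : PlacesOver L v => w'.1.adicCompletion L) w) ((γ.val : GL (Fin 3) (UnitaryGroup.LocalRing L v)) : Matrix (Fin 3) (Fin 3) (UnitaryGroup.LocalRing L v)).trace)} →
      ∫ g, φ g * α g ∂νQv = ∫ m, torusTransform L v mQv μM φ m * ((((vanDijkWeight L v (torusChart L v m)).re : ℝ) : ℂ) * α (((torusChart L v m : ↥(cmBorelTriple L 3 v).M) : ↥(unitaryGroupOfForm (conjLocal L (IsCMField.complexConj L) v) (cmLocalForm L 3 v))) : Gqs L v)) ∂μM) := by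
    intro α hαm hαli hαinv φ hφ hsupp
    rw [hWIF0 α hαm hαli hαinv φ hφ hsupp]
    refine integral_congr_ae (Filter.Eventually.of_forall fun m => ?_)
    dsimp only
    by_cases hm : m ∈ ((Submonoid.pi Set.univ (fun w : PlacesOver L v => (w.1.adicCompletionIntegers L).toSubring.toSubmonoid)).units.prod (⊤ : Subgroup ↥(normOneUnits (conjLocal L (IsCMField.complexConj L) v))))
    · haveI : Subsingleton (PlacesOver L v) := PlacesOver.subsingleton_of_smul_eq (IsCMField.complexConj L) (IsCMField.complexConj_ne_one L) w (hns w)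
      have hv1 : Valued.v ((m.1 : UnitaryGroup.LocalRing L v) w) = 1 := (mem_unitsIntegers_iff L v m.1).1 (Subgroup.mem_prod.1 hm).1 w
      have hnot : ¬ (1 < Valued.v ((Pi.evalRingHom (fun w' : PlacesOver L v => w'.1.adicCompletion L) w) (((((torusChart L v m : ↥(cmBorelTriple L 3 v).M) : ↥(unitaryGroupOfForm (conjLocal L (IsCMField.complexConj L) v) (cmLocalForm L 3 v))) : GL (Fin 3) (UnitaryGroup.LocalRing L v)) : Matrix (Fin 3) (Fin 3) (UnitaryGroup.LocalRing L v)).trace))) :=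
        fun h => ((one_lt_v_trace_torusChart_iff L v hns w m).1 h) hv1
      have hO : classOrbitalIntegral mQv φ (ConjClasses.mk (((torusChart L v m : ↥(cmBorelTriple L 3 v).M) : ↥(unitaryGroupOfForm (conjLocal L (IsCMField.complexConj L) v) (cmLocalForm L 3 v))) : Gqs L v)) = 0 := by
        refine classOrbitalIntegral_mk_eq_zero_of_forall_conj_notMem_tsupport mQv fun y hy => hnot ?_
        exact (conj_mem_setOf_one_lt_v_trace_iff L v w _ y).1 (hsupp hy)
      have hT : torusTransform L v mQv μM φ m = 0 := by
        show (_ : ℂ) * (vanDijkWeight L v (torusChart L v m) * classOrbitalIntegral mQv φ (ConjClasses.mk (((torusChart L v m : ↥(cmBorelTriple L 3 v).M) : ↥(unitaryGroupOfForm (conjLocal L (IsCMField.complexConj L) v) (cmLocalForm L 3 v))) : Gqs L v))) = 0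
        rw [hO, mul_zero, mul_zero]
      rw [hT, zero_mul, zero_mul]
    · rw [F0P3cStCharTSShellWeight.vanDijkWeight_torusChart_of_not_mem L v hns m hm, Complex.ofReal_re]
  refine ⟨torusTransform L v mQv μM, {γ : Gqs L v | 1 < Valued.v ((Pi.evalRingHom (fun w' : PlacesOver L v => w'.1.adicCompletion L) w) ((γ.val : GL (Fin 3) (UnitaryGroup.LocalRing L v)) : Matrix (Fin 3) (Fin 3) (UnitaryGroup.LocalRing L v)).trace)}, pairChar L v, fun χ m => pairChar_apply L v χ m, ?_, ?_, ?_, hSHF⟩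
  · -- (WM∕L2M): `Θ_σ := Δ∘ι · χ_σ ∘ ι` — regularity from (M1) at `𝔇.IsL2 σ` (COMPAT `hμGZ`), class function from (CHAR-CL)
    intro σ hσ
    have hL2 : 𝔇.IsL2 σ := by
      show IrrClass.IsSquareIntegrable 𝔇.μGZ σ
      rw [hμGZ]; exact hσ
    obtain ⟨hmeas, hli, -, htr⟩ := hHC σ hL2
    have hcl := hCL σ hL2
    refine ⟨fun m => (((vanDijkWeight L v (torusChart L v m)).re : ℝ) : ℂ) * 𝔇.char σ (((torusChart L v m : ↥(cmBorelTriple L 3 v).M) : ↥(unitaryGroupOfForm (conjLocal L (IsCMField.complexConj L) v) (cmLocalForm L 3 v))) : Gqs L v),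
      hL1 σ hσ, ?_⟩
    rintro φ ⟨hφ, hsupp⟩
    rw [hμG] at hli htr
    rw [htr φ hφ]
    exact hWIF (𝔇.char σ) hmeas hli (hclΩ _ hcl) φ hφ hsupp
  · -- (HM): `Θ_ρ := Δ∘ι · χ_ρ^G ∘ ι`, `χ_ρ^G = 𝔇.up (packetCharH {πSt})`
    obtain ⟨hmeasH, hliH, hstH, -, htrH⟩ := hHCH {πSt} hρ
    obtain ⟨hmeasU, hclU, hupId⟩ := hUp (𝔇.packetCharH {πSt}) hmeasH hstH
    have hL1up : Integrable (fun m : ((LocalRing L v)ˣ × ↥(normOneUnits (conjLocal L (IsCMField.complexConj L) v))) => (((vanDijkWeight L v (torusChart L v m)).re : ℝ) : ℂ) * 𝔇.up (𝔇.packetCharH {πSt}) (((torusChart L v m : ↥(cmBorelTriple L 3 v).M) : ↥(unitaryGroupOfForm (conjLocal L (IsCMField.complexConj L) v) (cmLocalForm L 3 v))) : Gqs L v)) μM :=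
      F0P3cStCharTSL1MSplit.integrable_of_compactPart_bound_of_shell_decay L v hns μM _ (hΔm.mul (hmeasU.comp hιm)).aestronglyMeasurable Bup hBup Cup sup hsup hCup
    refine ⟨fun m => (((vanDijkWeight L v (torusChart L v m)).re : ℝ) : ℂ) * 𝔇.up (𝔇.packetCharH {πSt}) (((torusChart L v m : ↥(cmBorelTriple L 3 v).M) : ↥(unitaryGroupOfForm (conjLocal L (IsCMField.complexConj L) v) (cmLocalForm L 3 v))) : Gqs L v),
      hL1up, ?_⟩
    rintro φ fH ⟨hφ, hsupp⟩ ⟨hfH, htrans⟩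
    have hliU : LocallyIntegrable (𝔇.up (𝔇.packetCharH {πSt})) 𝔇.μG := (hUpReg {πSt} hρ).1
    -- (M1H) at the singleton packet `{πSt}`: `Tr πSt(fH) = ∫_H fH · χ_ρ`
    have h1 : πSt.smoothTrace νHv fH = ∫ h, fH h * 𝔇.packetCharH {πSt} h ∂𝔇.μH := by
      have h := htrH fH hfH
      rw [Finset.sum_singleton, hμH] at h
      rw [hμH]; exact h
    -- `UpSpec` at the transfer pair `(φ, fH)`: `∫_G φ · χ_ρ^G = ∫_H fH · χ_ρ` (convergence: local integrability × compact supports)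
    have hφSB : φ ∈ SchwartzBruhat (Gqs L v) := hφ
    have hintG : Integrable (fun g => φ g * 𝔇.up (𝔇.packetCharH {πSt}) g) 𝔇.μG := by
      simpa only [smul_eq_mul] using hliU.integrable_smul_left_of_hasCompactSupport hφ.1.continuous hφ.2
    have hintH : Integrable (fun h => fH h * 𝔇.packetCharH {πSt} h) 𝔇.μH := by
      simpa only [smul_eq_mul] using hliH.integrable_smul_left_of_hasCompactSupport hfH.1.continuous hfH.2
    have h2 := hupId φ hφSB fH ((hTr φ fH).mpr htrans) hintG hintH
    rw [h1, ← h2, hμG]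
    rw [hμG] at hliU
    exact hWIF _ hmeasU hliU (hclΩ _ hclU) φ hφ hsupp
  · -- (PSM) on `Ω°`: ★ p849653 (no support condition is used by its proof; we feed `Ω° ⊆ hyperbolicSet`)
    intro χ hχ1 hχ2 φ hφ
    exact psm_torusTransform L v hns νQv mQv hcanQ μM hVDW χ hχ1 hχ2 φ ⟨hφ.1, hφ.2.trans hΩhyp⟩

end Summit.HodgeConjecture.HodgeConjecture.Cruxes.H413.F0P3cStCharTSSaHeadTorus9

end
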